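import Summits.Parity.GeneralizedHardyLittlewood.Theorems.PrimeLevelFamEdgeMomentsBeyondDiagonalDiagCoprime
import Summits.Parity.GeneralizedHardyLittlewood.Theorems.PrimeLevelFamEdgeMomentsBeyondDiagonalDiagDecorTools
import HarnessLib

/-!
# Route `PrimeLevelFamEdge`, crux K_A `MomentsBeyondDiagonal` (stmt-Parity-20007), line «petersson_layers» v4, stub `stub_diag`:
# **the log-power decorated coprime Selberg sum:
# `Σ_{k≤y,(k,n)=1} τ(k)W(k)·logᵃk·logᶜ(y/k) = κ_{a,c}·E_n·log^{a+c−2}y + O_{a,c}(D(n)(1+log y)^{a+c−3})`**,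
# `κ_{a,c} = Σ_β C(a,β)(−1)^β(c+β)(c+β−1)` (`= c(c−1), −2c, 2, 0, 0, …` for `a = 0, 1, 2, 3, 4, …`)

Census R3(ii), ANALYTIC HALF, the FREE decoration (reduction (i) of the roadmap in
`Cruxes/MomentsBeyondDiagonal/Lines/petersson_layers_stub_diag_g6_q1_profile.md`): in the decorated Selberg
coordinates of `…DiagOrderSelberg` the divisor sums `τ_{α,β}(k)` of the log-decorations are, on squarefree `k`,
`τ(k)·Poly(log k, P₂(k), …)` (`…DiagDecorMult`, `…DiagDecorTau2`); the powers of `log k` are removed by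
`log k = log y − log(y/k)` (`…DiagDecorTools.sum_mul_log_pow_mul_log_div_pow_eq`), which turns the `logᵃk`-decorated
coprime sum into a binomial combination of the UNDECORATED sums `S⁽ᶜ⁺ᵝ⁾(y;n) = Σ_{k≤y} a_n(k)log^{c+β}(y/k)`
(`a_n = copTauW n = τ·W·[(·,n)=1]`) evaluated by `…DiagCoprime.abs_coprimeSumPow_sub_le` (`c+β ≥ 3`) and
`KernelFormXSqCore.abs_coprimeSum_sub_le` (`c+β = 2`):

* `abs_coprimeSumPow_sub_le_of_two_le` — the two undecorated engines in ONE format for every order `m ≥ 2`: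
  `|S⁽ᵐ⁾(y;n) − m(m−1)E_n log^{m−2}y| ≤ C_m·D(n)(1+log y)^{m−2}/(1+log y)`;
* `abs_coprimeSumPow_logPow_sub_le` — **every `a ≥ 0`, `c ≥ 2`:
  `|Σ_{k≤y} a_n(k)·logᵃk·logᶜ(y/k) − κ_{a,c}·E_n·log^{a+c−2}y| ≤ C_{a,c}·D(n)·(1+log y)^{a+c−2}/(1+log y)`**,
  `κ_{a,c} = Σ_{β≤a} C(a,β)(−1)^β(c+β)(c+β−1)` (an `a`-th finite difference of a quadratic: it vanishes for `a ≥ 3`);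
* `abs_coprimeSumPow_log_sub_le` (`a = 1`, `κ = −2c`) and `abs_coprimeSumPow_logSq_sub_le` (`a = 2`, `κ = 2`), error
  `C·D(n)(1+log y)^{a+c−3}` — the decorations `τ_{1,0} = ½τ log` and the `log²k` halves of `τ_{1,1}`, `τ_{2,0}`.

With `…DiagDecorPrimeSq` (the `P₂(k) = Σ_{p∣k}log²p` halves, coefficient `−2`): on squarefree `k`,
`Σ a_n(k)·(τ_{1,1}(k)/τ(k))·logᶜ(y/k) = (2−(−2))/4·E_n logᶜy + O = E_n logᶜy + O(D(n)(1+κ(n))(1+log y)^{c−1})` and the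
`τ_{2,0}` analogue has leading coefficient `(2+(−2))/4 = 0`. Def-free; theorems only. Helper `--supports stmt-Parity-20007`;
closes nothing; K_A, K_B and the Parity summit are NOT proved; nothing about Landau–Siegel zeros.

## References
* E. Kowalski, P. Michel, J. VanderKam, J. reine angew. Math. 526 (2000), (23)–(28) pp. 13–15 and Prop. 5.1 p. 18
  (the residue evaluation of the diagonal main term; here the log-decorations of a general `Q` in real variables).
  [cite: KowalskiMichelVanderKam2000, (23)–(28) — derivation (log-power decoration of the Selberg coordinates)]
* H. L. Montgomery, R. C. Vaughan, *Multiplicative Number Theory I*, CUP 2007, §8.1. [cite: MontgomeryVaughan2007, §8.1 — derivation]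
-/

noncomputable section

open scoped Real
open Finset ArithmeticFunction

namespace Summit.Parity.GeneralizedHardyLittlewood.Theorems.MomentsBeyondDiagonal.DiagKernel

open Literature.NumberTheory.LFunctions Literature.NumberTheory.LFunctions.KMV2000
open Summit.Parity.GeneralizedHardyLittlewood.Theorems.BeyondDiagonalBeatsQuarter.KernelFormXSq
  (copTauW mainConst divWeight divWeight_nonneg mainConst_nonneg coprimeSum abs_coprimeSum_sub_le)
open Summit.Parity.GeneralizedHardyLittlewood.Theorems.MomentsBeyondDiagonal.DiagLines
  (sum_mul_log_pow_mul_log_div_pow_eq)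

/-- **The undecorated engines in one format**: for every `m ≥ 2` there is `C_m > 0` with
`|S⁽ᵐ⁾(y;n) − m(m−1)E_n log^{m−2}y| ≤ C_m·D(n)·(1+log y)^{m−2}/(1+log y)` for all `n ≥ 1`, `y ≥ 1`
(`m ≥ 3`: `…DiagCoprime.abs_coprimeSumPow_sub_le`; `m = 2`: `KernelFormXSqCore.abs_coprimeSum_sub_le`, `1/(1+log y)² ≤ 1/(1+log y)`).
[cite: KowalskiMichelVanderKam2000, Prop. 5.1 — derivation] -/
theorem abs_coprimeSumPow_sub_le_of_two_le {m : ℕ} (hm : 2 ≤ m) :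
    ∃ C : ℝ, 0 < C ∧ ∀ n : ℕ, n ≠ 0 → ∀ y : ℝ, 1 ≤ y →
      |∑ k ∈ Icc 1 ⌊y⌋₊, copTauW n k * Real.log (y / k) ^ m -
          (m : ℝ) * ((m : ℝ) - 1) * mainConst n * Real.log y ^ (m - 2)| ≤
        C * divWeight n * (1 + Real.log y) ^ (m - 2) / (1 + Real.log y) := by
  rcases Nat.lt_or_ge m 3 with h3 | h3
  · have hm2 : m = 2 := by omega
    subst hm2
    obtain ⟨C, hC, h⟩ := abs_coprimeSum_sub_le
    refine ⟨C, hC, fun n hn y hy ↦ ?_⟩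
    have hly : 0 ≤ Real.log y := Real.log_nonneg hy
    have hD := divWeight_nonneg n
    have h' := h n hn y hy
    simp only [coprimeSum] at h'
    have hL : (1 : ℝ) ≤ 1 + Real.log y := by linarith
    norm_num
    calc _ ≤ C * divWeight n / (1 + Real.log y) ^ 2 := h'
      _ ≤ C * divWeight n / (1 + Real.log y) := by
          apply div_le_div_of_nonneg_left (by positivity) (by positivity)
          nlinarith
  · obtain ⟨C, hC, h⟩ := abs_coprimeSumPow_sub_le h3
    refine ⟨C, hC, fun n hn y hy ↦ ?_⟩
    have hly : 0 ≤ Real.log y := Real.log_nonneg hy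
    have hL0 : (0 : ℝ) < 1 + Real.log y := by linarith
    have e : m - 2 = (m - 3) + 1 := by omega
    calc _ ≤ C * divWeight n * (1 + Real.log y) ^ (m - 3) := h n hn y hy
      _ = C * divWeight n * (1 + Real.log y) ^ (m - 2) / (1 + Real.log y) := by
          rw [e, pow_succ]
          field_simp

/-- **The log-power decorated coprime Selberg sum.** For every `a ≥ 0` and `c ≥ 2` there is `C_{a,c}` such that for all
`n ≥ 1`, `y ≥ 1`:
`|Σ_{k≤y} a_n(k)·logᵃk·logᶜ(y/k) − κ_{a,c}·E_n·log^{a+c−2}y| ≤ C_{a,c}·D(n)·(1+log y)^{a+c−2}/(1+log y)`,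
`κ_{a,c} = Σ_{β≤a} C(a,β)(−1)^β(c+β)(c+β−1)`.
[cite: KowalskiMichelVanderKam2000, (23)–(28) and Prop. 5.1 — derivation (log-power decoration, real variables)] -/
theorem abs_coprimeSumPow_logPow_sub_le (a : ℕ) {c : ℕ} (hc : 2 ≤ c) :
    ∃ C : ℝ, 0 < C ∧ ∀ n : ℕ, n ≠ 0 → ∀ y : ℝ, 1 ≤ y →
      |∑ k ∈ Icc 1 ⌊y⌋₊, copTauW n k * Real.log k ^ a * Real.log (y / k) ^ c -
          (∑ β ∈ Finset.range (a + 1), (a.choose β : ℝ) * (-1) ^ β *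
            (((c + β : ℕ) : ℝ) * (((c + β : ℕ) : ℝ) - 1))) * mainConst n * Real.log y ^ (a + c - 2)| ≤
        C * divWeight n * (1 + Real.log y) ^ (a + c - 2) / (1 + Real.log y) := by
  -- one constant per order `c + β`
  have hex : ∀ β : ℕ, ∃ C : ℝ, 0 < C ∧ ∀ n : ℕ, n ≠ 0 → ∀ y : ℝ, 1 ≤ y →
      |∑ k ∈ Icc 1 ⌊y⌋₊, copTauW n k * Real.log (y / k) ^ (c + β) -
          ((c + β : ℕ) : ℝ) * (((c + β : ℕ) : ℝ) - 1) * mainConst n * Real.log y ^ (c + β - 2)| ≤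
        C * divWeight n * (1 + Real.log y) ^ (c + β - 2) / (1 + Real.log y) :=
    fun β ↦ abs_coprimeSumPow_sub_le_of_two_le (by omega)
  choose Cf hCf0 hCf using hex
  have hS0 : 0 ≤ ∑ β ∈ Finset.range (a + 1), (a.choose β : ℝ) * Cf β :=
    Finset.sum_nonneg fun β _ ↦ mul_nonneg (Nat.cast_nonneg _) (hCf0 β).le
  refine ⟨∑ β ∈ Finset.range (a + 1), (a.choose β : ℝ) * Cf β + 1, by linarith, fun n hn y hy ↦ ?_⟩
  have hy0 : 0 < y := by linarith
  have hly : 0 ≤ Real.log y := Real.log_nonneg hy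
  have hL0 : (0 : ℝ) < 1 + Real.log y := by linarith
  have hD := divWeight_nonneg n
  -- Step 1: the binomial expansion `log k = log y − log(y/k)`
  have h := sum_mul_log_pow_mul_log_div_pow_eq hy0 (fun k : ℕ ↦ copTauW n k) a c
  beta_reduce at h
  rw [h]
  -- Step 2: termwise differences
  have hmain : (∑ β ∈ Finset.range (a + 1), (a.choose β : ℝ) * (-1) ^ β *
      (((c + β : ℕ) : ℝ) * (((c + β : ℕ) : ℝ) - 1))) * mainConst n * Real.log y ^ (a + c - 2) =
      ∑ β ∈ Finset.range (a + 1), (a.choose β : ℝ) * Real.log y ^ (a - β) * (-1) ^ β *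
        (((c + β : ℕ) : ℝ) * (((c + β : ℕ) : ℝ) - 1) * mainConst n * Real.log y ^ (c + β - 2)) := by
    rw [Finset.sum_mul, Finset.sum_mul]
    refine Finset.sum_congr rfl fun β hβ ↦ ?_
    have hβ' : β < a + 1 := Finset.mem_range.1 hβ
    have e : a + c - 2 = (a - β) + (c + β - 2) := by omega
    rw [e, pow_add]
    ring
  rw [hmain, ← Finset.sum_sub_distrib]
  have hterm : ∀ β ∈ Finset.range (a + 1),
      |(a.choose β : ℝ) * Real.log y ^ (a - β) * (-1) ^ β *
          ∑ k ∈ Icc 1 ⌊y⌋₊, copTauW n k * Real.log (y / k) ^ (c + β) -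
        (a.choose β : ℝ) * Real.log y ^ (a - β) * (-1) ^ β *
          (((c + β : ℕ) : ℝ) * (((c + β : ℕ) : ℝ) - 1) * mainConst n * Real.log y ^ (c + β - 2))| ≤
      (a.choose β : ℝ) * Cf β * (divWeight n * (1 + Real.log y) ^ (a + c - 2) / (1 + Real.log y)) := by
    intro β hβ
    have hβ' : β < a + 1 := Finset.mem_range.1 hβ
    rw [← mul_sub, abs_mul, abs_mul, abs_mul, abs_pow, abs_pow, abs_neg, abs_one, one_pow, mul_one,
      abs_of_nonneg (by positivity : (0 : ℝ) ≤ (a.choose β : ℝ)), abs_of_nonneg hly]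
    have hin := hCf β n hn y hy
    have hlog : Real.log y ^ (a - β) ≤ (1 + Real.log y) ^ (a - β) :=
      pow_le_pow_left₀ hly (by linarith) _
    have e : a + c - 2 = (a - β) + (c + β - 2) := by omega
    calc (a.choose β : ℝ) * Real.log y ^ (a - β) *
          |∑ k ∈ Icc 1 ⌊y⌋₊, copTauW n k * Real.log (y / k) ^ (c + β) -
            ((c + β : ℕ) : ℝ) * (((c + β : ℕ) : ℝ) - 1) * mainConst n * Real.log y ^ (c + β - 2)|
        ≤ (a.choose β : ℝ) * (1 + Real.log y) ^ (a - β) *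
            (Cf β * divWeight n * (1 + Real.log y) ^ (c + β - 2) / (1 + Real.log y)) := by
          gcongr
      _ = (a.choose β : ℝ) * Cf β * (divWeight n * (1 + Real.log y) ^ (a + c - 2) / (1 + Real.log y)) := by
          rw [e, pow_add]
          field_simp
  -- Step 3: sum the termwise bounds
  calc _ ≤ ∑ β ∈ Finset.range (a + 1),
        |(a.choose β : ℝ) * Real.log y ^ (a - β) * (-1) ^ β *
            ∑ k ∈ Icc 1 ⌊y⌋₊, copTauW n k * Real.log (y / k) ^ (c + β) -
          (a.choose β : ℝ) * Real.log y ^ (a - β) * (-1) ^ β *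
            (((c + β : ℕ) : ℝ) * (((c + β : ℕ) : ℝ) - 1) * mainConst n * Real.log y ^ (c + β - 2))| :=
        Finset.abs_sum_le_sum_abs _ _
    _ ≤ ∑ β ∈ Finset.range (a + 1),
        (a.choose β : ℝ) * Cf β * (divWeight n * (1 + Real.log y) ^ (a + c - 2) / (1 + Real.log y)) :=
        Finset.sum_le_sum hterm
    _ = (∑ β ∈ Finset.range (a + 1), (a.choose β : ℝ) * Cf β) *
        divWeight n * (1 + Real.log y) ^ (a + c - 2) / (1 + Real.log y) := by
        rw [Finset.sum_mul, Finset.sum_mul, Finset.sum_div]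
        refine Finset.sum_congr rfl fun β _ ↦ by ring
    _ ≤ (∑ β ∈ Finset.range (a + 1), (a.choose β : ℝ) * Cf β + 1) *
        divWeight n * (1 + Real.log y) ^ (a + c - 2) / (1 + Real.log y) := by
        gcongr
        linarith

/-- **The `log k`-decorated coprime Selberg sum** (`a = 1`, `κ_{1,c} = c(c−1) − (c+1)c = −2c`): for `c ≥ 2`,
`|Σ_{k≤y} a_n(k)·log k·logᶜ(y/k) + 2c·E_n·log^{c−1}y| ≤ C·D(n)·(1+log y)^{c−2}` (so `τ_{1,0} = ½τ·log` contributes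
`−c·E_n log^{c−1}y`). [cite: KowalskiMichelVanderKam2000, (23)–(28) and Prop. 5.1 — derivation] -/
theorem abs_coprimeSumPow_log_sub_le {c : ℕ} (hc : 2 ≤ c) :
    ∃ C : ℝ, 0 < C ∧ ∀ n : ℕ, n ≠ 0 → ∀ y : ℝ, 1 ≤ y →
      |∑ k ∈ Icc 1 ⌊y⌋₊, copTauW n k * Real.log k * Real.log (y / k) ^ c +
          2 * (c : ℝ) * mainConst n * Real.log y ^ (c - 1)| ≤
        C * divWeight n * (1 + Real.log y) ^ (c - 2) := by
  obtain ⟨C, hC, h⟩ := abs_coprimeSumPow_logPow_sub_le 1 hc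
  refine ⟨C, hC, fun n hn y hy ↦ ?_⟩
  have hly : 0 ≤ Real.log y := Real.log_nonneg hy
  have hL0 : (0 : ℝ) < 1 + Real.log y := by linarith
  have h' := h n hn y hy
  have hcoef : (∑ β ∈ Finset.range (1 + 1), ((1 : ℕ).choose β : ℝ) * (-1) ^ β *
      (((c + β : ℕ) : ℝ) * (((c + β : ℕ) : ℝ) - 1))) = -(2 * (c : ℝ)) := by
    simp only [Finset.sum_range_succ, Finset.sum_range_zero]
    push_cast
    norm_num
    ring
  have e1 : 1 + c - 2 = c - 1 := by omega
  have e2 : c - 1 = (c - 2) + 1 := by omega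
  rw [hcoef, e1] at h'
  simp only [pow_one] at h'
  calc _ = |∑ k ∈ Icc 1 ⌊y⌋₊, copTauW n k * Real.log k * Real.log (y / k) ^ c -
          -(2 * (c : ℝ)) * mainConst n * Real.log y ^ (c - 1)| := by ring_nf
    _ ≤ C * divWeight n * (1 + Real.log y) ^ (c - 1) / (1 + Real.log y) := h'
    _ = C * divWeight n * (1 + Real.log y) ^ (c - 2) := by
        rw [e2, pow_succ]
        field_simp

/-- **The `log²k`-decorated coprime Selberg sum** (`a = 2`, `κ_{2,c} = c(c−1) − 2(c+1)c + (c+2)(c+1) = 2`): for `c ≥ 2`,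
`|Σ_{k≤y} a_n(k)·log²k·logᶜ(y/k) − 2·E_n·logᶜy| ≤ C·D(n)·(1+log y)^{c−1}` (with `…DiagDecorPrimeSq`: the `τ_{1,1}`-decorated
sum has leading coefficient `(2−(−2))/4 = 1`, the `τ_{2,0}`-decorated one `(2+(−2))/4 = 0`).
[cite: KowalskiMichelVanderKam2000, (23)–(28) and Prop. 5.1 — derivation] -/
theorem abs_coprimeSumPow_logSq_sub_le {c : ℕ} (hc : 2 ≤ c) :
    ∃ C : ℝ, 0 < C ∧ ∀ n : ℕ, n ≠ 0 → ∀ y : ℝ, 1 ≤ y →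
      |∑ k ∈ Icc 1 ⌊y⌋₊, copTauW n k * Real.log k ^ 2 * Real.log (y / k) ^ c -
          2 * mainConst n * Real.log y ^ c| ≤
        C * divWeight n * (1 + Real.log y) ^ (c - 1) := by
  obtain ⟨C, hC, h⟩ := abs_coprimeSumPow_logPow_sub_le 2 hc
  refine ⟨C, hC, fun n hn y hy ↦ ?_⟩
  have hly : 0 ≤ Real.log y := Real.log_nonneg hy
  have hL0 : (0 : ℝ) < 1 + Real.log y := by linarith
  have h' := h n hn y hy
  have hcoef : (∑ β ∈ Finset.range (2 + 1), ((2 : ℕ).choose β : ℝ) * (-1) ^ β *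
      (((c + β : ℕ) : ℝ) * (((c + β : ℕ) : ℝ) - 1))) = 2 := by
    simp only [Finset.sum_range_succ, Finset.sum_range_zero]
    push_cast
    norm_num
    ring
  have e1 : 2 + c - 2 = c := by omega
  have e2 : c = (c - 1) + 1 := by omega
  rw [hcoef, e1] at h'
  calc _ ≤ C * divWeight n * (1 + Real.log y) ^ c / (1 + Real.log y) := h'
    _ = C * divWeight n * (1 + Real.log y) ^ (c - 1) := by
        conv_lhs => rw [e2, pow_succ]
        field_simp

end Summit.Parity.GeneralizedHardyLittlewood.Theorems.MomentsBeyondDiagonal.DiagKernel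

end
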